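import Summits.QuantumFields.YangMills.Theorems.FluctuationComparisonRegPrIntLBackgroundFormAlgebra
import Literature.MathematicalPhysics.QuantumFieldTheory.Balaban1983to89.T3MinimiserStabilityReduction
import Literature.MathematicalPhysics.QuantumFieldTheory.Balaban1983to89.T3PrintedRegularMinimiser
import Literature.MathematicalPhysics.QuantumFieldTheory.Balaban1983to89.T3OrbitAverage
import Literature.MathematicalPhysics.QuantumFieldTheory.Balaban1983to89.B12ContinuousTransportInvariance
import Literature.MathematicalPhysics.QuantumFieldTheory.Balaban1983to89.Node00.CanonicalTransportOfRecord
import HarnessLib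

/-!
# LINE g24-4 «BACKGROUND FORM» v2 (COARSE CELLS ∕ CELL MAP), LIFTED INTO `Theorems/`: BGFORM∘ v2 ⟹ S2β (registry :412 VERBATIM) AND BGFORM∘ v2 ⟹ GRAD∘, DEFINITION-FREE

Cell `ym3-torus` (YM ladder rung R3 = continuum `SU(2)` Yang–Mills on the three-torus — a RUNG, NOT d = 4, NOT infinite volume, NOT a mass gap, NOT Clay).  Width seat
`ym-ust-20520-w4` (gen 20); `--supports stmt-QuantumFields-20520 --as helper`, count-neutral, definition-free, default heartbeats; no registry, binder or `Lines/`
edit; the registered skeleton `Lines/semiclassical_s2beta.lean` v11.4 and its five stubs are untouched (0∕5).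

WHAT THIS IS.  Ideator `ym-r3-idea-1` g24's LINE №14 = g24-4 «background_form» **v2** (`Cruxes/FluctuationComparisonRegPrIntL/Lines/background_form.lean` sha16
22880983c54704f6 — P1 of critic #496 repaired in types; card `Lines/background_form.md` v2.1) re-types the row **BGFORM∘** `FluctuationBackgroundFormCan`: the terms
`T X` are indexed by finite sets `X` of COARSE (level-`J`) bonds, the registers of the BACKGROUND MAP `M` stay on the FINE (level-`K`) bonds, a CELL MAP
`blk : PBond (F.P K) 0 → PBond (F.P J) 0` assigns fine bonds to coarse cells, the symmetric pseudo-metric `d` and EVERY count (`Σ_{c′} e^{−μd(c,c′)} ≤ C`, one-pin sums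
`≤ A`, two-pin sums `≤ H e^{−2μd(c,c′)}`) live on the COARSE lattice (`K` enters no constant), the terms are CELL-SUM LIPSCHITZ ∕ DISCRETE-C^{1,1} in the fine variables
of the blocks of `X`, and the one-bond ∕ mixed two-bond RESPONSES of `M` are per fine bond with decay `e^{−2μd(b, blk e)}` ∕ `e^{−2μd(b, blk e)} e^{−2μd(blk e, b′)}`
([Balaban1985Variational] Prop. 9 p.309, (182)–(190) pp.307–308; [Balaban1987RG1] (0.22)–(0.25) pp.256–257; [Balaban1989LargeFieldII] (1.98)–(1.100) p.390).  The
v2 file PROVES again, from that row, BOTH the PATH-B organ **S2β** `RunPairOrgan.OneLoop.FluctuationPartSmall` (registry :412) and LINE g24-1's first-order row **GRAD∘**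
`OneBondOscillationCan`, through the CELL forms of the sensitivity algebra.  Crux workfiles are not importable and the v1 lifts ✓`…BackgroundFormKnit` conclude from
v1's text (anchor `π`, fine-bond pseudo-metric), which v2 supersedes; so this file LIFTS the v2 junctions into `Theorems/` with the three statements written out
VERBATIM as propositions (no `def`): §0 the two cell-form lemmas `oneBond_le_of_cellLipschitz` ∕ `fourPoint_le_of_cellC11` (g24's §2, new statements; the unchanged
exchange ∕ convolution ∕ super-polynomial lemmas are IMPORTED from ✓`…BackgroundFormAlgebra`, not restated), §1 ★`oneBondOscillation_of_backgroundFormCell :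
⟨BGFORM∘ v2⟩ → ⟨GRAD∘⟩` (`σ^{GRAD}_J := A·C′·σ_J`), §2 ★`fluctuationPartSmall_of_backgroundFormCell : ⟨BGFORM∘ v2⟩ → ⟨S2β⟩` (`κ_{S2β} := κ`,
`φ_J := H·C′²·σ_J² + A·C′·σ₂,J`, `C′ = max C 0`; S2β's `e^{−κ·tdist}` is MANUFACTURED from the background response by two-pin exchange and the three-factor convolution
on the COARSE lattice).  Proofs: g24's v2 §3 verbatim.  All credit for the mathematics: ideator g24 (this seat only lifts).

POSITION IN THE CONE (card v2.1 + critic #496∕#496b, honest).  In `Theorems/` after this file: POLY∘ v2 →(J2 ✓`…BackgroundFormOfPolymer`) BGFORM∘ v1 →(H2) {S2β, GRAD∘}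
(v1 text, of record against 5f006530) and BGFORM∘ v2 →(this file) {S2β, GRAD∘}; the v2 editions of (J) and of w5's analytic knit dock on THIS file's `hB` text.
The line is ADMISSIBLE and UNSTAFFABLE (critic #496b: the (resp1)∕uniform-`C` clause is SUSPENDED pending the re-sealed guidance column FL-15′); a lift is
count-neutral plumbing, not staffing of the row.  WHY IT MIGHT FAIL (card): (a) last Mayer step; (b) dictionary; (c) moduli are Cauchy corollaries; (d) torons;
(f) product-kernel shape of the mixed response; (g) GAUGE ∕ CHART — `M`, `blk`, `d` are ANY maps, print-faithfulness is a reading.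

HONEST: two knits and two finite-sum lemmas; BGFORM∘ v2 is a HYPOTHESIS (the line's one stub, XL) and appears here only as an antecedent; nothing of Bałaban's is
asserted or proved; S2β and GRAD∘ are proved only modulo BGFORM∘ v2; `FluctuationComparisonRegPrIntL` (20520) and `YM3TorusSU2` are NOT proved; no summit ∕
sub-problem statement is proved; rung R3 = SU(2) YM₃ on T³ — NOT d = 4, NOT infinite volume, NOT a mass gap, NOT Clay.
[cite: Balaban1985Variational, Prop. 9 p.309, (182)-(190) pp.307-308; Balaban1987RG1, (0.22)-(0.25) pp.256-257, Thm 1 p.259; Balaban1989LargeFieldII, (1.98)-(1.100) p.390; Balaban1985UV3, Thm 2 p.263 and (41) p.266]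
-/

set_option autoImplicit false

noncomputable section

namespace Summit.QuantumFields.YangMills.Theorems.FluctuationComparisonRegPrIntLBackgroundFormCellKnit

open MeasureTheory Filter Topology Set
open scoped BigOperators
open Literature.MathematicalPhysics.QuantumFieldTheory.Balaban1983to89
open Literature.MathematicalPhysics.QuantumFieldTheory.Balaban1983to89.T3ContinuumYM3Torus
open Literature.MathematicalPhysics.QuantumFieldTheory.Balaban1983to89.T3NestedUnitLaws
open Literature.MathematicalPhysics.QuantumFieldTheory.Balaban1983to89.T3UnitLawDensityEML
open Literature.MathematicalPhysics.QuantumFieldTheory.Balaban1983to89.T3UnitScaleTilt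
open Literature.MathematicalPhysics.QuantumFieldTheory.Balaban1983to89.T3TiltDescent
open Literature.MathematicalPhysics.QuantumFieldTheory.Balaban1983to89.T3PrintedRegularMinimiser
open Literature.MathematicalPhysics.QuantumFieldTheory.Balaban1983to89.T3ConstrainedMinimiser (fibre)
open Literature.MathematicalPhysics.QuantumFieldTheory.Balaban1983to89.T3LevelShift
open Literature.MathematicalPhysics.QuantumFieldTheory.Balaban1983to89.Missing
open Literature.MathematicalPhysics.QuantumFieldTheory.Balaban1983to89.T4Continuum
open Summit.QuantumFields.YangMills.Theorems.FluctuationComparisonRegPrIntLBackgroundFormAlgebra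

/-! ## §0 The sensitivity algebra in CELL form (g24's v2 §2; new statements — the exchange ∕ convolution lemmas are imported from ✓`…BackgroundFormAlgebra`) -/

section AlgebraCell

variable {ι G H 𝓒 E : Type*} [Fintype 𝓒] [NormedAddCommGroup H]

/-- **First order (cell form).** One-bond oscillation of `f = c₀ + Σ_X T X ∘ M` (terms indexed by finite sets `X` of COARSE cells, registers on FINE bonds `e`
with cell map `blk`) from cell-sum Lipschitz moduli of the terms and a cellwise bound `s (blk e)` on the one-bond response of the background map.  Statement and
proof: LINE g24-4 v2 §2 (ideator g24), lifted. [folklore] -/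
theorem oneBond_le_of_cellLipschitz
    (blk : E → 𝓒) (T : Finset 𝓒 → (E → H) → ℝ) (ℓ : Finset 𝓒 → ℝ) (M : (ι → G) → (E → H))
    (S : Set (ι → G)) (c₀ : ℝ) (f : (ι → G) → ℝ) (s : 𝓒 → ℝ) (hs : ∀ c, 0 ≤ s c)
    (hlip : ∀ X V V', V ∈ S → V' ∈ S → ∀ S₁ : 𝓒 → ℝ, (∀ c, 0 ≤ S₁ c) → (∀ e, blk e ∈ X → ‖M V e - M V' e‖ ≤ S₁ (blk e)) →
      |T X (M V) - T X (M V')| ≤ ℓ X * ∑ c ∈ X, S₁ c)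
    (hrep : ∀ V, V ∈ S → f V = c₀ + ∑ X, T X (M V))
    (V V' : ι → G) (hV : V ∈ S) (hV' : V' ∈ S)
    (hsens : ∀ e, ‖M V e - M V' e‖ ≤ s (blk e)) :
    |f V - f V'| ≤ ∑ X, ℓ X * ∑ c ∈ X, s c := by
  have hdiff : f V - f V' = ∑ X, (T X (M V) - T X (M V')) := by
    rw [hrep V hV, hrep V' hV', Finset.sum_sub_distrib]; ring
  rw [hdiff]
  refine (Finset.abs_sum_le_sum_abs _ _).trans (Finset.sum_le_sum fun X _ => ?_)
  exact hlip X V V' hV hV' s hs (fun e _ => hsens e)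

/-- **Second order (cell form).** The connected four-point difference of `f = c₀ + Σ_X T X ∘ M` over a square of window data
(`V₁₀` = `V₀₀` moved at `b`, `V₀₁` = `V₀₀` moved at `b'`, `V₁₁` = both) from cell-sum discrete-C^{1,1} moduli of the terms and cellwise bounds on the first- and
mixed second-order response of the background map.  Statement and proof: LINE g24-4 v2 §2 (ideator g24), lifted. [folklore] -/
theorem fourPoint_le_of_cellC11
    (blk : E → 𝓒) (T : Finset 𝓒 → (E → H) → ℝ) (ℓ h : Finset 𝓒 → ℝ) (M : (ι → G) → (E → H))
    (S : Set (ι → G)) (c₀ : ℝ) (f : (ι → G) → ℝ) (s s' s₂ : 𝓒 → ℝ)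
    (hs : ∀ c, 0 ≤ s c) (hs' : ∀ c, 0 ≤ s' c) (hs₂ : ∀ c, 0 ≤ s₂ c)
    (hC11 : ∀ X V₀₀ V₁₀ V₀₁ V₁₁, V₀₀ ∈ S → V₁₀ ∈ S → V₀₁ ∈ S → V₁₁ ∈ S →
      ∀ S₁ S₂ S₁₂ : 𝓒 → ℝ, (∀ c, 0 ≤ S₁ c) → (∀ c, 0 ≤ S₂ c) → (∀ c, 0 ≤ S₁₂ c) →
      (∀ e, blk e ∈ X → ‖M V₁₀ e - M V₀₀ e‖ ≤ S₁ (blk e)) →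
      (∀ e, blk e ∈ X → ‖M V₀₁ e - M V₀₀ e‖ ≤ S₂ (blk e)) →
      (∀ e, blk e ∈ X → ‖M V₁₁ e - M V₁₀ e - M V₀₁ e + M V₀₀ e‖ ≤ S₁₂ (blk e)) →
      |T X (M V₁₁) - T X (M V₁₀) - T X (M V₀₁) + T X (M V₀₀)| ≤
        h X * (∑ c ∈ X, S₁ c) * (∑ c ∈ X, S₂ c) + ℓ X * ∑ c ∈ X, S₁₂ c)
    (hrep : ∀ V, V ∈ S → f V = c₀ + ∑ X, T X (M V))
    (V₀₀ V₁₀ V₀₁ V₁₁ : ι → G) (h₀₀ : V₀₀ ∈ S) (h₁₀ : V₁₀ ∈ S) (h₀₁ : V₀₁ ∈ S) (h₁₁ : V₁₁ ∈ S)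
    (hsens₁ : ∀ e, ‖M V₁₀ e - M V₀₀ e‖ ≤ s (blk e)) (hsens₂ : ∀ e, ‖M V₀₁ e - M V₀₀ e‖ ≤ s' (blk e))
    (hsens₁₂ : ∀ e, ‖M V₁₁ e - M V₁₀ e - M V₀₁ e + M V₀₀ e‖ ≤ s₂ (blk e)) :
    |f V₁₁ - f V₁₀ - f V₀₁ + f V₀₀| ≤
      ∑ X, (h X * (∑ c ∈ X, s c) * (∑ c ∈ X, s' c) + ℓ X * ∑ c ∈ X, s₂ c) := by
  have hdiff : f V₁₁ - f V₁₀ - f V₀₁ + f V₀₀ =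
      ∑ X, (T X (M V₁₁) - T X (M V₁₀) - T X (M V₀₁) + T X (M V₀₀)) := by
    rw [hrep _ h₁₁, hrep _ h₁₀, hrep _ h₀₁, hrep _ h₀₀]
    simp only [Finset.sum_add_distrib, Finset.sum_sub_distrib]; ring
  rw [hdiff]
  refine (Finset.abs_sum_le_sum_abs _ _).trans (Finset.sum_le_sum fun X _ => ?_)
  exact hC11 X V₀₀ V₁₀ V₀₁ V₁₁ h₀₀ h₁₀ h₀₁ h₁₁ s s' s₂ hs hs' hs₂ (fun e _ => hsens₁ e) (fun e _ => hsens₂ e) (fun e _ => hsens₁₂ e)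

end AlgebraCell

/-! ## §1 BGFORM∘ v2 ⟹ GRAD∘ -/

/-- ★ **BGFORM∘ v2 ⟹ GRAD∘** (LINE g24-4 v2 §3, lifted; statements VERBATIM: antecedent = `Lines/background_form.lean` (22880983c54704f6) §1
`FluctuationBackgroundFormCan` v2 — coarse cells, cell map `blk`, coarse counts, cell-sum moduli, per-fine-bond responses; conclusion = LINE g24-1
`Lines/gradient_split.lean` §0 `OneBondOscillationCan`): cell-Lipschitz terms × one-bond response × one-pin exchange on the coarse lattice;
`σ^{GRAD}_J := A·(max C 0)·σ_J`.  Proof g24's. [cite: Balaban1987RG1, Thm 1 (0.24)-(0.25) p.257; Balaban1989LargeFieldII, (1.98)-(1.100) p.390; Balaban1985Variational, Prop. 9 p.309] -/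
theorem oneBondOscillation_of_backgroundFormCell
    (hB :
      ∀ (L : ℕ), ∃ pS : ℝ, ∀ (b₀ p₀ : ℝ), 0 < b₀ → pS ≤ p₀ → 0 < p₀ → ∃ ε₁ : ℝ, 0 < ε₁ ∧ ∀ (ε₀ : ℝ), 0 < ε₀ → ε₀ ≤ ε₁ →
        ∃ γ₁ : ℝ, 0 < γ₁ ∧ ∃ (κ μ C A Hc : ℝ), 0 < κ ∧ 0 ≤ μ ∧ 0 ≤ A ∧ 0 ≤ Hc ∧ ∀ (F : T3Family) (γ : ℝ), F.L = L → 0 < γ → γ ≤ γ₁ →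
          ∃ (σ σ₂ : ℕ → ℝ), (∀ J, 0 ≤ σ J) ∧ (∀ J, 0 ≤ σ₂ J) ∧
            (∀ a : ℕ, Tendsto (fun J : ℕ => ((J : ℝ) + 1) ^ a * σ J) atTop (𝓝 0)) ∧
            (∀ a : ℕ, Tendsto (fun J : ℕ => ((J : ℝ) + 1) ^ a * σ₂ J) atTop (𝓝 0)) ∧
            ∀ (ν : ℕ → (j : ℕ) → Measure (GaugeField (F.P j) 0 (Matrix.specialUnitaryGroup (Fin 2) ℂ))),
              (∀ K, ν K K = T4GenFunBounds.gibbsMeasure (F.P K) ((F.scheme ℰp γ).β K)) →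
              (∀ K j, j < K → ν K j = Measure.map (descend F ℰp j) (ν K (j + 1))) →
              ∀ (J K : ℕ) (hJK : J ≤ K) (ρ : GaugeField (F.P J) 0 (Matrix.specialUnitaryGroup (Fin 2) ℂ) → ℝ),
                (∀ U, PlaqSmall (θBal F.L γ b₀ p₀ J) U → 0 < ρ U) →
                ν K J = (fieldMeasure _ _ _).withDensity (fun U => ENNReal.ofReal (ρ U)) →
                ContinuousOn ρ {U | PlaqSmall (θBal F.L γ b₀ p₀ J) U} →
                ∃ (c₀ : ℝ) (d : PBond (F.P J) 0 → PBond (F.P J) 0 → ℝ) (blk : PBond (F.P K) 0 → PBond (F.P J) 0)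
                  (M : GaugeField (F.P J) 0 (Matrix.specialUnitaryGroup (Fin 2) ℂ) → PBond (F.P K) 0 → (Fin 8 → ℝ))
                  (T : Finset (PBond (F.P J) 0) → (PBond (F.P K) 0 → (Fin 8 → ℝ)) → ℝ)
                  (ℓ h : Finset (PBond (F.P J) 0) → ℝ),
                  (∀ x y, 0 ≤ d x y) ∧ (∀ x y, d x y = d y x) ∧ (∀ x y z, d x z ≤ d x y + d y z) ∧
                  (∀ x, ∑ y, Real.exp (-(μ * d x y)) ≤ C) ∧
                  (∀ b b' : PBond (F.P J) 0, κ * (b.src.tdist b'.src : ℝ) ≤ μ * d b b') ∧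
                  (∀ X, 0 ≤ ℓ X) ∧ (∀ X, 0 ≤ h X) ∧
                  (∀ c, ∑ X ∈ Finset.univ.filter (fun X => c ∈ X), ℓ X ≤ A) ∧
                  (∀ c c', ∑ X ∈ Finset.univ.filter (fun X => c ∈ X ∧ c' ∈ X), h X ≤ Hc * Real.exp (-(2 * μ * d c c'))) ∧
                  (∀ (X : Finset (PBond (F.P J) 0)) (U V : GaugeField (F.P J) 0 (Matrix.specialUnitaryGroup (Fin 2) ℂ)),
                      PlaqSmall (θBal F.L γ b₀ p₀ J) U → PlaqSmall (θBal F.L γ b₀ p₀ J) V →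
                      ∀ (S₁ : PBond (F.P J) 0 → ℝ), (∀ c, 0 ≤ S₁ c) →
                      (∀ e, blk e ∈ X → ‖M U e - M V e‖ ≤ S₁ (blk e)) →
                      |T X (M U) - T X (M V)| ≤ ℓ X * ∑ c ∈ X, S₁ c) ∧
                  (∀ (X : Finset (PBond (F.P J) 0)) (U V W Z : GaugeField (F.P J) 0 (Matrix.specialUnitaryGroup (Fin 2) ℂ)),
                      PlaqSmall (θBal F.L γ b₀ p₀ J) U → PlaqSmall (θBal F.L γ b₀ p₀ J) V →
                      PlaqSmall (θBal F.L γ b₀ p₀ J) W → PlaqSmall (θBal F.L γ b₀ p₀ J) Z →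
                      ∀ (S₁ S₂ S₁₂ : PBond (F.P J) 0 → ℝ), (∀ c, 0 ≤ S₁ c) → (∀ c, 0 ≤ S₂ c) → (∀ c, 0 ≤ S₁₂ c) →
                      (∀ e, blk e ∈ X → ‖M W e - M Z e‖ ≤ S₁ (blk e)) →
                      (∀ e, blk e ∈ X → ‖M V e - M Z e‖ ≤ S₂ (blk e)) →
                      (∀ e, blk e ∈ X → ‖M U e - M W e - M V e + M Z e‖ ≤ S₁₂ (blk e)) →
                      |T X (M U) - T X (M W) - T X (M V) + T X (M Z)| ≤
                        h X * (∑ c ∈ X, S₁ c) * (∑ c ∈ X, S₂ c) + ℓ X * ∑ c ∈ X, S₁₂ c) ∧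
                  (∀ (b : PBond (F.P J) 0) (U V : GaugeField (F.P J) 0 (Matrix.specialUnitaryGroup (Fin 2) ℂ)),
                      PlaqSmall (θBal F.L γ b₀ p₀ J) U → PlaqSmall (θBal F.L γ b₀ p₀ J) V → (∀ e, e ≠ b → U e = V e) →
                      ∀ e, ‖M U e - M V e‖ ≤ σ J * Real.exp (-(2 * μ * d b (blk e)))) ∧
                  (∀ (b b' : PBond (F.P J) 0) (U V W Z : GaugeField (F.P J) 0 (Matrix.specialUnitaryGroup (Fin 2) ℂ)),
                      PlaqSmall (θBal F.L γ b₀ p₀ J) U → PlaqSmall (θBal F.L γ b₀ p₀ J) V →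
                      PlaqSmall (θBal F.L γ b₀ p₀ J) W → PlaqSmall (θBal F.L γ b₀ p₀ J) Z →
                      (∀ e, e ≠ b → U e = V e) → (∀ e, e ≠ b' → U e = W e) → (∀ e, e ≠ b' → V e = Z e) → (∀ e, e ≠ b → W e = Z e) →
                      ∀ e, ‖M U e - M W e - M V e + M Z e‖ ≤
                        σ₂ J * (Real.exp (-(2 * μ * d b (blk e))) * Real.exp (-(2 * μ * d (blk e) b')))) ∧
                  (∀ U : GaugeField (F.P J) 0 (Matrix.specialUnitaryGroup (Fin 2) ℂ), PlaqSmall (θBal F.L γ b₀ p₀ J) U →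
                      Real.log (ρ U) + (F.scheme ℰp γ).β K * minActionRegPr F J K hJK ε₀ U = c₀ + ∑ X, T X (M U))) :
    ∀ (L : ℕ), ∃ pS : ℝ, ∀ (b₀ p₀ : ℝ), 0 < b₀ → pS ≤ p₀ → 0 < p₀ → ∃ ε₁ : ℝ, 0 < ε₁ ∧ ∀ (ε₀ : ℝ), 0 < ε₀ → ε₀ ≤ ε₁ →
      ∃ γ₁ : ℝ, 0 < γ₁ ∧ ∀ (F : T3Family) (γ : ℝ), F.L = L → 0 < γ → γ ≤ γ₁ →
        ∃ (σ : ℕ → ℝ), (∀ J, 0 ≤ σ J) ∧ (∀ a : ℕ, Tendsto (fun J : ℕ => ((J : ℝ) + 1) ^ a * σ J) atTop (𝓝 0)) ∧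
          ∀ (ν : ℕ → (j : ℕ) → Measure (GaugeField (F.P j) 0 (Matrix.specialUnitaryGroup (Fin 2) ℂ))),
            (∀ K, ν K K = T4GenFunBounds.gibbsMeasure (F.P K) ((F.scheme ℰp γ).β K)) →
            (∀ K j, j < K → ν K j = Measure.map (descend F ℰp j) (ν K (j + 1))) →
            ∀ (J K : ℕ) (hJK : J ≤ K) (ρ : GaugeField (F.P J) 0 (Matrix.specialUnitaryGroup (Fin 2) ℂ) → ℝ),
              (∀ U, PlaqSmall (θBal F.L γ b₀ p₀ J) U → 0 < ρ U) →
              ν K J = (fieldMeasure _ _ _).withDensity (fun U => ENNReal.ofReal (ρ U)) →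
              ContinuousOn ρ {U | PlaqSmall (θBal F.L γ b₀ p₀ J) U} →
              ∀ (b : PBond (F.P J) 0) (U V : GaugeField (F.P J) 0 (Matrix.specialUnitaryGroup (Fin 2) ℂ)),
                PlaqSmall (θBal F.L γ b₀ p₀ J) U → PlaqSmall (θBal F.L γ b₀ p₀ J) V →
                (∀ e, e ≠ b → U e = V e) →
                |(Real.log (ρ U) + (F.scheme ℰp γ).β K * minActionRegPr F J K hJK ε₀ U)
                    - (Real.log (ρ V) + (F.scheme ℰp γ).β K * minActionRegPr F J K hJK ε₀ V)| ≤ σ J := by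
  intro L
  obtain ⟨pS, HpS⟩ := hB L
  refine ⟨pS, ?_⟩
  intro b₀ p₀ hb₀ hpS hp₀
  obtain ⟨ε₁, hε₁, Hε⟩ := HpS b₀ p₀ hb₀ hpS hp₀
  refine ⟨ε₁, hε₁, ?_⟩
  intro ε₀ hε₀ hε₀₁
  obtain ⟨γ₁, hγ₁, κ, μ, C, A, Hc, _hκ, hμ, hA, _hHc, HF⟩ := Hε ε₀ hε₀ hε₀₁
  refine ⟨γ₁, hγ₁, ?_⟩
  intro F γ hFL hγ hγ₁'
  obtain ⟨σ, σ₂, hσ0, _hσ₂0, hσ, _hσ₂, Hν⟩ := HF F γ hFL hγ hγ₁'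
  refine ⟨fun J => A * max C 0 * σ J, fun J => mul_nonneg (mul_nonneg hA (le_max_right _ _)) (hσ0 J),
    superpoly_const_mul (A * max C 0) hσ, ?_⟩
  intro ν hνK hνd J K hJK ρ hρpos hρν hρcont b U V hU hV hUV
  obtain ⟨c₀, d, blk, M, T, ℓ, h, hd0, _hdsym, _hdtri, hdsum, _hdcmp, hℓ0, _hh0, hpin1, _hpin2, hlip, _hC11, hsens1, _hsens2, hrep⟩ :=
    Hν ν hνK hνd J K hJK ρ hρpos hρν hρcont
  set S : Set (GaugeField (F.P J) 0 (Matrix.specialUnitaryGroup (Fin 2) ℂ)) := {U | PlaqSmall (θBal F.L γ b₀ p₀ J) U} with hS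
  have hs0 : ∀ c : PBond (F.P J) 0, 0 ≤ σ J * Real.exp (-(2 * μ * d b c)) := fun c => mul_nonneg (hσ0 J) (Real.exp_pos _).le
  have key := oneBond_le_of_cellLipschitz blk T ℓ M S c₀
    (fun U => Real.log (ρ U) + (F.scheme ℰp γ).β K * minActionRegPr F J K hJK ε₀ U)
    (fun (c : PBond (F.P J) 0) => σ J * Real.exp (-(2 * μ * d b c))) hs0
    (fun X U' V' hU' hV' S₁ hS₁ hb => hlip X U' V' hU' hV' S₁ hS₁ hb)
    (fun V hV => hrep V hV) U V hU hV (hsens1 b U V hU hV hUV)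
  refine key.trans ?_
  have hC0 : 0 ≤ max C 0 := le_max_right _ _
  have hB : ∑ c, σ J * Real.exp (-(2 * μ * d b c)) ≤ σ J * max C 0 := by
    rw [← Finset.mul_sum]
    refine mul_le_mul_of_nonneg_left ?_ (hσ0 J)
    calc ∑ c, Real.exp (-(2 * μ * d b c)) ≤ ∑ c, Real.exp (-(μ * d b c)) :=
          Finset.sum_le_sum fun c _ => exp_two_mul_le μ _ hμ (hd0 _ _)
      _ ≤ C := hdsum b
      _ ≤ max C 0 := le_max_left _ _
  have := sum_mul_sum_supp_le (fun X : Finset (PBond (F.P J) 0) => X) ℓ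
    (fun c => σ J * Real.exp (-(2 * μ * d b c))) A (σ J * max C 0)
    hs0 hpin1 hB hA
  calc ∑ X, ℓ X * ∑ c ∈ X, σ J * Real.exp (-(2 * μ * d b c)) ≤ A * (σ J * max C 0) := this
    _ = A * max C 0 * σ J := by ring

/-! ## §2 BGFORM∘ v2 ⟹ S2β -/

/-- ★ **BGFORM∘ v2 ⟹ S2β** (LINE g24-4 v2 §3, lifted; statements VERBATIM: antecedent = `Lines/background_form.lean` (22880983c54704f6) §1 `FluctuationBackgroundFormCan`
v2, conclusion = the PATH-B organ `RunPairOrgan.OneLoop.FluctuationPartSmall`, registry `Lines/semiclassical_s2beta.lean` v11.4 :412): cell-C^{1,1} terms × first-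
and mixed second-order response × two-pin exchange × exponential convolutions on the coarse lattice; `κ_{S2β} := κ`, `φ_J := H·C′²·σ_J² + A·C′·σ₂,J` (`C′ = max C 0`).
Proof g24's. [cite: Balaban1985UV3, Thm 2 p.263 and (41) p.266; Balaban1987RG1, (0.22)-(0.25) pp.256-257; Balaban1985Variational, (182)-(190) pp.307-308] -/
theorem fluctuationPartSmall_of_backgroundFormCell
    (hB :
      ∀ (L : ℕ), ∃ pS : ℝ, ∀ (b₀ p₀ : ℝ), 0 < b₀ → pS ≤ p₀ → 0 < p₀ → ∃ ε₁ : ℝ, 0 < ε₁ ∧ ∀ (ε₀ : ℝ), 0 < ε₀ → ε₀ ≤ ε₁ →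
        ∃ γ₁ : ℝ, 0 < γ₁ ∧ ∃ (κ μ C A Hc : ℝ), 0 < κ ∧ 0 ≤ μ ∧ 0 ≤ A ∧ 0 ≤ Hc ∧ ∀ (F : T3Family) (γ : ℝ), F.L = L → 0 < γ → γ ≤ γ₁ →
          ∃ (σ σ₂ : ℕ → ℝ), (∀ J, 0 ≤ σ J) ∧ (∀ J, 0 ≤ σ₂ J) ∧
            (∀ a : ℕ, Tendsto (fun J : ℕ => ((J : ℝ) + 1) ^ a * σ J) atTop (𝓝 0)) ∧
            (∀ a : ℕ, Tendsto (fun J : ℕ => ((J : ℝ) + 1) ^ a * σ₂ J) atTop (𝓝 0)) ∧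
            ∀ (ν : ℕ → (j : ℕ) → Measure (GaugeField (F.P j) 0 (Matrix.specialUnitaryGroup (Fin 2) ℂ))),
              (∀ K, ν K K = T4GenFunBounds.gibbsMeasure (F.P K) ((F.scheme ℰp γ).β K)) →
              (∀ K j, j < K → ν K j = Measure.map (descend F ℰp j) (ν K (j + 1))) →
              ∀ (J K : ℕ) (hJK : J ≤ K) (ρ : GaugeField (F.P J) 0 (Matrix.specialUnitaryGroup (Fin 2) ℂ) → ℝ),
                (∀ U, PlaqSmall (θBal F.L γ b₀ p₀ J) U → 0 < ρ U) →
                ν K J = (fieldMeasure _ _ _).withDensity (fun U => ENNReal.ofReal (ρ U)) →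
                ContinuousOn ρ {U | PlaqSmall (θBal F.L γ b₀ p₀ J) U} →
                ∃ (c₀ : ℝ) (d : PBond (F.P J) 0 → PBond (F.P J) 0 → ℝ) (blk : PBond (F.P K) 0 → PBond (F.P J) 0)
                  (M : GaugeField (F.P J) 0 (Matrix.specialUnitaryGroup (Fin 2) ℂ) → PBond (F.P K) 0 → (Fin 8 → ℝ))
                  (T : Finset (PBond (F.P J) 0) → (PBond (F.P K) 0 → (Fin 8 → ℝ)) → ℝ)
                  (ℓ h : Finset (PBond (F.P J) 0) → ℝ),
                  (∀ x y, 0 ≤ d x y) ∧ (∀ x y, d x y = d y x) ∧ (∀ x y z, d x z ≤ d x y + d y z) ∧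
                  (∀ x, ∑ y, Real.exp (-(μ * d x y)) ≤ C) ∧
                  (∀ b b' : PBond (F.P J) 0, κ * (b.src.tdist b'.src : ℝ) ≤ μ * d b b') ∧
                  (∀ X, 0 ≤ ℓ X) ∧ (∀ X, 0 ≤ h X) ∧
                  (∀ c, ∑ X ∈ Finset.univ.filter (fun X => c ∈ X), ℓ X ≤ A) ∧
                  (∀ c c', ∑ X ∈ Finset.univ.filter (fun X => c ∈ X ∧ c' ∈ X), h X ≤ Hc * Real.exp (-(2 * μ * d c c'))) ∧
                  (∀ (X : Finset (PBond (F.P J) 0)) (U V : GaugeField (F.P J) 0 (Matrix.specialUnitaryGroup (Fin 2) ℂ)),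
                      PlaqSmall (θBal F.L γ b₀ p₀ J) U → PlaqSmall (θBal F.L γ b₀ p₀ J) V →
                      ∀ (S₁ : PBond (F.P J) 0 → ℝ), (∀ c, 0 ≤ S₁ c) →
                      (∀ e, blk e ∈ X → ‖M U e - M V e‖ ≤ S₁ (blk e)) →
                      |T X (M U) - T X (M V)| ≤ ℓ X * ∑ c ∈ X, S₁ c) ∧
                  (∀ (X : Finset (PBond (F.P J) 0)) (U V W Z : GaugeField (F.P J) 0 (Matrix.specialUnitaryGroup (Fin 2) ℂ)),
                      PlaqSmall (θBal F.L γ b₀ p₀ J) U → PlaqSmall (θBal F.L γ b₀ p₀ J) V →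
                      PlaqSmall (θBal F.L γ b₀ p₀ J) W → PlaqSmall (θBal F.L γ b₀ p₀ J) Z →
                      ∀ (S₁ S₂ S₁₂ : PBond (F.P J) 0 → ℝ), (∀ c, 0 ≤ S₁ c) → (∀ c, 0 ≤ S₂ c) → (∀ c, 0 ≤ S₁₂ c) →
                      (∀ e, blk e ∈ X → ‖M W e - M Z e‖ ≤ S₁ (blk e)) →
                      (∀ e, blk e ∈ X → ‖M V e - M Z e‖ ≤ S₂ (blk e)) →
                      (∀ e, blk e ∈ X → ‖M U e - M W e - M V e + M Z e‖ ≤ S₁₂ (blk e)) →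
                      |T X (M U) - T X (M W) - T X (M V) + T X (M Z)| ≤
                        h X * (∑ c ∈ X, S₁ c) * (∑ c ∈ X, S₂ c) + ℓ X * ∑ c ∈ X, S₁₂ c) ∧
                  (∀ (b : PBond (F.P J) 0) (U V : GaugeField (F.P J) 0 (Matrix.specialUnitaryGroup (Fin 2) ℂ)),
                      PlaqSmall (θBal F.L γ b₀ p₀ J) U → PlaqSmall (θBal F.L γ b₀ p₀ J) V → (∀ e, e ≠ b → U e = V e) →
                      ∀ e, ‖M U e - M V e‖ ≤ σ J * Real.exp (-(2 * μ * d b (blk e)))) ∧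
                  (∀ (b b' : PBond (F.P J) 0) (U V W Z : GaugeField (F.P J) 0 (Matrix.specialUnitaryGroup (Fin 2) ℂ)),
                      PlaqSmall (θBal F.L γ b₀ p₀ J) U → PlaqSmall (θBal F.L γ b₀ p₀ J) V →
                      PlaqSmall (θBal F.L γ b₀ p₀ J) W → PlaqSmall (θBal F.L γ b₀ p₀ J) Z →
                      (∀ e, e ≠ b → U e = V e) → (∀ e, e ≠ b' → U e = W e) → (∀ e, e ≠ b' → V e = Z e) → (∀ e, e ≠ b → W e = Z e) →
                      ∀ e, ‖M U e - M W e - M V e + M Z e‖ ≤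
                        σ₂ J * (Real.exp (-(2 * μ * d b (blk e))) * Real.exp (-(2 * μ * d (blk e) b')))) ∧
                  (∀ U : GaugeField (F.P J) 0 (Matrix.specialUnitaryGroup (Fin 2) ℂ), PlaqSmall (θBal F.L γ b₀ p₀ J) U →
                      Real.log (ρ U) + (F.scheme ℰp γ).β K * minActionRegPr F J K hJK ε₀ U = c₀ + ∑ X, T X (M U))) :
    ∀ (L : ℕ), ∃ pS : ℝ, ∀ (b₀ p₀ : ℝ), 0 < b₀ → pS ≤ p₀ → 0 < p₀ → ∃ ε₁ : ℝ, 0 < ε₁ ∧ ∀ (ε₀ : ℝ), 0 < ε₀ → ε₀ ≤ ε₁ →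
      ∃ γ₁ : ℝ, 0 < γ₁ ∧ ∃ κ : ℝ, 0 < κ ∧ ∀ (F : T3Family) (γ : ℝ), F.L = L → 0 < γ → γ ≤ γ₁ →
        ∃ (φ : ℕ → ℝ), (∀ J, 0 ≤ φ J) ∧ Tendsto (fun J : ℕ => (J : ℝ) * φ J) atTop (𝓝 0) ∧
          ∀ (ν : ℕ → (j : ℕ) → Measure (GaugeField (F.P j) 0 (Matrix.specialUnitaryGroup (Fin 2) ℂ))),
            (∀ K, ν K K = T4GenFunBounds.gibbsMeasure (F.P K) ((F.scheme ℰp γ).β K)) →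
            (∀ K j, j < K → ν K j = Measure.map (descend F ℰp j) (ν K (j + 1))) →
            ∀ (J K : ℕ) (hJK : J ≤ K) (ρ : GaugeField (F.P J) 0 (Matrix.specialUnitaryGroup (Fin 2) ℂ) → ℝ),
              (∀ U, PlaqSmall (θBal F.L γ b₀ p₀ J) U → 0 < ρ U) →
              ν K J = (fieldMeasure _ _ _).withDensity (fun U => ENNReal.ofReal (ρ U)) →
              ContinuousOn ρ {U | PlaqSmall (θBal F.L γ b₀ p₀ J) U} →
              ∀ (b b' : PBond (F.P J) 0) (U V W Z : GaugeField (F.P J) 0 (Matrix.specialUnitaryGroup (Fin 2) ℂ)),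
                PlaqSmall (θBal F.L γ b₀ p₀ J) U → PlaqSmall (θBal F.L γ b₀ p₀ J) V →
                PlaqSmall (θBal F.L γ b₀ p₀ J) W → PlaqSmall (θBal F.L γ b₀ p₀ J) Z →
                (∀ e, e ≠ b → U e = V e) → (∀ e, e ≠ b' → U e = W e) → (∀ e, e ≠ b' → V e = Z e) → (∀ e, e ≠ b → W e = Z e) →
                |((Real.log (ρ U) + (F.scheme ℰp γ).β K * minActionRegPr F J K hJK ε₀ U)
                    - (Real.log (ρ V) + (F.scheme ℰp γ).β K * minActionRegPr F J K hJK ε₀ V))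
                  - ((Real.log (ρ W) + (F.scheme ℰp γ).β K * minActionRegPr F J K hJK ε₀ W)
                    - (Real.log (ρ Z) + (F.scheme ℰp γ).β K * minActionRegPr F J K hJK ε₀ Z))|
                  ≤ φ J * Real.exp (-(κ * (b.src.tdist b'.src : ℝ))) := by
  intro L
  obtain ⟨pS, HpS⟩ := hB L
  refine ⟨pS, ?_⟩
  intro b₀ p₀ hb₀ hpS hp₀
  obtain ⟨ε₁, hε₁, Hε⟩ := HpS b₀ p₀ hb₀ hpS hp₀
  refine ⟨ε₁, hε₁, ?_⟩
  intro ε₀ hε₀ hε₀₁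
  obtain ⟨γ₁, hγ₁, κ, μ, C, A, Hc, hκ, hμ, hA, hHc, HF⟩ := Hε ε₀ hε₀ hε₀₁
  refine ⟨γ₁, hγ₁, κ, hκ, ?_⟩
  intro F γ hFL hγ hγ₁'
  obtain ⟨σ, σ₂, hσ0, hσ₂0, hσ, hσ₂, Hν⟩ := HF F γ hFL hγ hγ₁'
  set C' : ℝ := max C 0 with hC'
  have hC'0 : 0 ≤ C' := le_max_right _ _
  refine ⟨fun J => Hc * C' ^ 2 * σ J ^ 2 + A * C' * σ₂ J,
    fun J => add_nonneg (mul_nonneg (mul_nonneg hHc (sq_nonneg _)) (sq_nonneg _)) (mul_nonneg (mul_nonneg hA hC'0) (hσ₂0 J)),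
    tendsto_phi_of_superpoly Hc C' A hσ0 hσ₂0 hσ hσ₂, ?_⟩
  intro ν hνK hνd J K hJK ρ hρpos hρν hρcont b b' U V W Z hU hV hW hZ hUV hUW hVZ hWZ
  obtain ⟨c₀, d, blk, M, T, ℓ, h, hd0, hdsym, hdtri, hdsum, hdcmp, hℓ0, hh0, hpin1, hpin2, hlip, hC11, hsens1, hsens2, hrep⟩ :=
    Hν ν hνK hνd J K hJK ρ hρpos hρν hρcont
  have hdsum' : ∀ x, ∑ y, Real.exp (-(μ * d x y)) ≤ C' := fun x => (hdsum x).trans (le_max_left _ _)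
  set S : Set (GaugeField (F.P J) 0 (Matrix.specialUnitaryGroup (Fin 2) ℂ)) := {U | PlaqSmall (θBal F.L γ b₀ p₀ J) U} with hS
  set f : GaugeField (F.P J) 0 (Matrix.specialUnitaryGroup (Fin 2) ℂ) → ℝ :=
    fun U => Real.log (ρ U) + (F.scheme ℰp γ).β K * minActionRegPr F J K hJK ε₀ U with hf
  set s : PBond (F.P J) 0 → PBond (F.P J) 0 → ℝ := fun b c => σ J * Real.exp (-(2 * μ * d b c)) with hs
  set s₂ : PBond (F.P J) 0 → ℝ := fun c => σ₂ J * (Real.exp (-(2 * μ * d b c)) * Real.exp (-(2 * μ * d c b'))) with hs₂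
  have hs0 : ∀ b c, 0 ≤ s b c := fun b c => mul_nonneg (hσ0 J) (Real.exp_pos _).le
  have hs₂0 : ∀ c, 0 ≤ s₂ c := fun c => mul_nonneg (hσ₂0 J) (mul_nonneg (Real.exp_pos _).le (Real.exp_pos _).le)
  -- the square: V₀₀ := Z, V₁₀ := W (moved at b), V₀₁ := V (moved at b'), V₁₁ := U
  have key := fourPoint_le_of_cellC11 blk T ℓ h M S c₀ f (s b) (s b') s₂ (hs0 b) (hs0 b') hs₂0
    (fun X Z' W' V' U' hZ' hW' hV' hU' S₁ S₂ S₁₂ hS₁ hS₂ hS₁₂ h1 h2 h12 =>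
      hC11 X U' V' W' Z' hU' hV' hW' hZ' S₁ S₂ S₁₂ hS₁ hS₂ hS₁₂ h1 h2 h12)
    (fun V hV => hrep V hV) Z W V U hZ hW hV hU
    (fun e => by
      have := hsens1 b W Z hW hZ hWZ e
      simpa [hs] using this)
    (fun e => by
      have := hsens1 b' V Z hV hZ hVZ e
      simpa [hs] using this)
    (fun e => by
      have := hsens2 b b' U V W Z hU hV hW hZ hUV hUW hVZ hWZ e
      simpa [hs₂] using this)
  have hrw : (f U - f V) - (f W - f Z) = f U - f W - f V + f Z := by ring
  show |(f U - f V) - (f W - f Z)| ≤ _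
  rw [hrw]
  refine key.trans ?_
  rw [Finset.sum_add_distrib]
  -- (1) the `h`-term: two-pin exchange + three-factor convolution
  have hK : ∀ c c', ∑ X ∈ Finset.univ.filter (fun X => c ∈ X ∧ c' ∈ X), h X ≤ Hc * Real.exp (-(2 * μ * d c c')) := hpin2
  have h1 := sum_mul_sum_mul_sum_supp_le (fun X : Finset (PBond (F.P J) 0) => X) h (s b) (s b')
    (fun c c' => Hc * Real.exp (-(2 * μ * d c c'))) (hs0 b) (hs0 b') hK
  have h1' : ∑ c, ∑ c', s b c * s b' c' * (Hc * Real.exp (-(2 * μ * d c c'))) =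
      σ J ^ 2 * Hc * ∑ c, ∑ c', Real.exp (-(2 * μ * d b c)) * Real.exp (-(2 * μ * d c c')) * Real.exp (-(2 * μ * d c' b')) := by
    rw [Finset.mul_sum]
    refine Finset.sum_congr rfl fun c _ => ?_
    rw [Finset.mul_sum]
    refine Finset.sum_congr rfl fun c' _ => ?_
    simp only [hs]
    rw [hdsym b' c']
    ring
  have hconv := exp_convolution_le d μ C' hμ hd0 hdtri hdsum' b b'
  have hterm1 : ∑ X, h X * (∑ c ∈ X, s b c) * (∑ c' ∈ X, s b' c') ≤ σ J ^ 2 * Hc * (C' ^ 2 * Real.exp (-(μ * d b b'))) := by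
    refine h1.trans ?_
    rw [h1']
    exact mul_le_mul_of_nonneg_left hconv (mul_nonneg (sq_nonneg _) hHc)
  -- (2) the `ℓ`-term: one-pin exchange + two-factor convolution
  have hB2 : ∑ c, s₂ c ≤ σ₂ J * (C' * Real.exp (-(μ * d b b'))) := by
    simp only [hs₂]
    rw [← Finset.mul_sum]
    exact mul_le_mul_of_nonneg_left (exp_convolution_two_le d μ C' hμ hd0 hdtri hdsum' b b') (hσ₂0 J)
  have hterm2 : ∑ X, ℓ X * ∑ c ∈ X, s₂ c ≤ A * (σ₂ J * (C' * Real.exp (-(μ * d b b')))) :=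
    sum_mul_sum_supp_le (fun X : Finset (PBond (F.P J) 0) => X) ℓ s₂ A _ hs₂0 hpin1 hB2 hA
  -- (3) compare the exponents: `κ·tdist ≤ μ·d b b'`
  have hexp : Real.exp (-(μ * d b b')) ≤ Real.exp (-(κ * (b.src.tdist b'.src : ℝ))) := by
    rw [Real.exp_le_exp]; linarith [hdcmp b b']
  have hφ1 : 0 ≤ σ J ^ 2 * Hc * C' ^ 2 := mul_nonneg (mul_nonneg (sq_nonneg _) hHc) (sq_nonneg _)
  have hφ2 : 0 ≤ A * (σ₂ J * C') := mul_nonneg hA (mul_nonneg (hσ₂0 J) hC'0)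
  calc ∑ X, h X * (∑ c ∈ X, s b c) * (∑ c' ∈ X, s b' c') + ∑ X, ℓ X * ∑ c ∈ X, s₂ c
      ≤ σ J ^ 2 * Hc * (C' ^ 2 * Real.exp (-(μ * d b b'))) + A * (σ₂ J * (C' * Real.exp (-(μ * d b b')))) :=
        add_le_add hterm1 hterm2
    _ = (σ J ^ 2 * Hc * C' ^ 2 + A * (σ₂ J * C')) * Real.exp (-(μ * d b b')) := by ring
    _ ≤ (σ J ^ 2 * Hc * C' ^ 2 + A * (σ₂ J * C')) * Real.exp (-(κ * (b.src.tdist b'.src : ℝ))) :=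
        mul_le_mul_of_nonneg_left hexp (add_nonneg hφ1 hφ2)
    _ = (Hc * C' ^ 2 * σ J ^ 2 + A * C' * σ₂ J) * Real.exp (-(κ * (b.src.tdist b'.src : ℝ))) := by ring

end Summit.QuantumFields.YangMills.Theorems.FluctuationComparisonRegPrIntLBackgroundFormCellKnit

end
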